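import Mathlib

/-!
# Permutation matrices of a finite `G`-set and the double commutant of their span
(route GelfandPairHosts, helper for item RankFormula, stmt-MatrixMultiplication-7385)

For a finite group `G` acting on a finite set `X` let `P_g ∈ ℂ^{X×X}` be the permutation matrix
`P_g(y,x) = [g·x = y]`, `A = span{P_g}` (a unital subalgebra of `ℂ^{X×X}`, the image of `ℂ[G]`)
and `A' = {B : B(g·x, g·y) = B(x,y)}` the `G`-invariant matrices (the commutant of `A`).

Main result `mem_permSpan_of_commute_invariant`: the (finite-dimensional von Neumann) double
commutant theorem for this algebra — a matrix commuting with every `G`-invariant matrix lies in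
`A`.  Proof: average an arbitrary linear projection onto `A` over `G` (Maschke) to get an
`A`-equivariant projection `Π` onto `A`; the "column maps" of `Π` are `G`-invariant matrices, so a
bicommutant element `T` satisfies `Π(T M) = T Π(M)`, whence `T = T Π(1) = Π(T) ∈ A`.

No definitions are declared: `P_g` and `A` are local notations for the literal expressions used
in the route statement `RankFormula`.
-/

set_option linter.dupNamespace false

noncomputable section

namespace Summit.MatrixMultiplication.MatrixMultiplication.Theorems

open scoped BigOperators
open Matrix

namespace GelfandRankFormula

variable {G : Type} [Group G] {X : Type} [DecidableEq X] [MulAction G X]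

/-- `P_g`, the permutation matrix of `g` on `ℂ^X` (local notation). -/
local notation3 "𝐏[" g "]" =>
  Matrix.of fun (y : X) (x : X) => if g • x = y then (1 : ℂ) else 0

/-- `A = span{P_g}` (local notation). -/
local notation3 "𝐀" => Submodule.span ℂ (Set.range fun g : G => 𝐏[g])

/-- Entries of the permutation matrix. -/
theorem permMat_apply (g : G) (y x : X) :
    (𝐏[g]) y x = if g • x = y then (1 : ℂ) else 0 := rfl

/-- `P_1 = 1`. -/
theorem permMat_one : 𝐏[(1 : G)] = (1 : Matrix X X ℂ) := by
  ext y x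
  rw [permMat_apply, one_smul, Matrix.one_apply]
  exact if_congr eq_comm rfl rfl

/-- `P_g ∈ A`. -/
theorem permMat_mem (g : G) : 𝐏[g] ∈ 𝐀 := Submodule.subset_span ⟨g, rfl⟩

/-- `1 = P_1 ∈ A`. -/
theorem one_mem_permSpan : (1 : Matrix X X ℂ) ∈ 𝐀 := by
  rw [← permMat_one (G := G)]
  exact permMat_mem 1

variable [Fintype X]

/-- Left multiplication by `P_g` permutes rows: `(P_g M)(y, x) = M(g⁻¹ y, x)`. -/
theorem permMat_mul_apply (g : G) (M : Matrix X X ℂ) (y x : X) :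
    (𝐏[g] * M) y x = M (g⁻¹ • y) x := by
  simp only [Matrix.mul_apply, permMat_apply, ite_mul, one_mul, zero_mul]
  rw [Finset.sum_eq_single (g⁻¹ • y)]
  · rw [if_pos (smul_inv_smul g y)]
  · intro z _ hz
    rw [if_neg]
    intro h
    exact hz (by rw [← h, inv_smul_smul])
  · intro h
    exact absurd (Finset.mem_univ _) h

/-- Right multiplication by `P_g` permutes columns: `(M P_g)(y, x) = M(y, g x)`. -/
theorem mul_permMat_apply (M : Matrix X X ℂ) (g : G) (y x : X) :
    (M * 𝐏[g]) y x = M y (g • x) := by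
  simp only [Matrix.mul_apply, permMat_apply, mul_ite, mul_one, mul_zero]
  rw [Finset.sum_eq_single (g • x)]
  · rw [if_pos rfl]
  · intro z _ hz
    rw [if_neg (Ne.symm hz)]
  · intro h
    exact absurd (Finset.mem_univ _) h

/-- `P_{gh} = P_g P_h`. -/
theorem permMat_mul (g h : G) : 𝐏[g * h] = 𝐏[g] * 𝐏[h] := by
  ext y x
  rw [permMat_mul_apply, permMat_apply, permMat_apply]
  simp only [mul_smul, eq_inv_smul_iff]

/-- `P_{g⁻¹} (P_g M) = M`. -/
theorem permMat_inv_mul_cancel (g : G) (M : Matrix X X ℂ) : 𝐏[g⁻¹] * (𝐏[g] * M) = M := by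
  rw [← Matrix.mul_assoc, ← permMat_mul, inv_mul_cancel, permMat_one, Matrix.one_mul]

/-- `P_g (P_{g⁻¹} M) = M`. -/
theorem permMat_mul_inv_cancel (g : G) (M : Matrix X X ℂ) : 𝐏[g] * (𝐏[g⁻¹] * M) = M := by
  rw [← Matrix.mul_assoc, ← permMat_mul, mul_inv_cancel, permMat_one, Matrix.one_mul]

/-- `P_g v = (y ↦ v(g⁻¹ y))`. -/
theorem permMat_mulVec (g : G) (v : X → ℂ) : 𝐏[g] *ᵥ v = fun y => v (g⁻¹ • y) := by
  funext y
  have := permMat_mul_apply g (Matrix.of fun z (_ : X) => v z) y y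
  rw [Matrix.mul_apply] at this
  simpa [Matrix.mulVec, dotProduct] using this

/-- `A` is stable under left multiplication by `P_g`. -/
theorem permMat_mul_mem (g : G) {a : Matrix X X ℂ} (ha : a ∈ 𝐀) : 𝐏[g] * a ∈ 𝐀 := by
  induction ha using Submodule.span_induction with
  | mem x hx =>
    obtain ⟨h, rfl⟩ := hx
    have e : 𝐏[g] * 𝐏[h] = 𝐏[g * h] := (permMat_mul g h).symm
    rw [e]
    exact permMat_mem _
  | zero => rw [Matrix.mul_zero]; exact Submodule.zero_mem _
  | add x y _ _ hx hy =>
    rw [mul_add]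
    exact add_mem hx hy
  | smul c x _ hx =>
    rw [Matrix.mul_smul]
    exact Submodule.smul_mem _ c hx

/-- `A` is closed under multiplication. -/
theorem mul_mem_permSpan {a b : Matrix X X ℂ} (ha : a ∈ 𝐀) (hb : b ∈ 𝐀) : a * b ∈ 𝐀 := by
  induction ha using Submodule.span_induction with
  | mem x hx =>
    obtain ⟨g, rfl⟩ := hx
    exact permMat_mul_mem g hb
  | zero => rw [Matrix.zero_mul]; exact Submodule.zero_mem _
  | add x y _ _ hx hy =>
    rw [add_mul]
    exact add_mem hx hy
  | smul c x _ hx =>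
    rw [Matrix.smul_mul]
    exact Submodule.smul_mem _ c hx

/-- Invariant matrices commute with the permutation matrices. -/
theorem permMat_mul_eq_of_invariant {B : Matrix X X ℂ}
    (hB : ∀ (g : G) (x y : X), B (g • x) (g • y) = B x y) (g : G) :
    𝐏[g] * B = B * 𝐏[g] := by
  ext y x
  rw [permMat_mul_apply, mul_permMat_apply, ← hB g (g⁻¹ • y) x, smul_inv_smul]

/-- A matrix commuting with all permutation matrices is invariant. -/
theorem invariant_of_commute {B : Matrix X X ℂ} (h : ∀ g : G, 𝐏[g] * B = B * 𝐏[g])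
    (g : G) (x y : X) : B (g • x) (g • y) = B x y := by
  have := congr_fun (congr_fun (h g) (g • x)) y
  rw [permMat_mul_apply, mul_permMat_apply, inv_smul_smul] at this
  exact this.symm

/-- `P_g E_{x l} = E_{g x, l}` for the matrix units. -/
theorem permMat_mul_single (g : G) (x l : X) (c : ℂ) :
    𝐏[g] * Matrix.single x l c = Matrix.single (g • x) l c := by
  ext y z
  rw [permMat_mul_apply]
  simp only [Matrix.single_apply, eq_inv_smul_iff]

variable [Fintype G]

/-- **Double commutant theorem** for the permutation module `ℂ^X`: a matrix that commutes with
every `G`-invariant matrix is a linear combination of the permutation matrices `P_g`. -/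
theorem mem_permSpan_of_commute_invariant (T : Matrix X X ℂ)
    (hT : ∀ B : Matrix X X ℂ, (∀ (g : G) (x y : X), B (g • x) (g • y) = B x y) →
      T * B = B * T) : T ∈ 𝐀 := by
  classical
  obtain ⟨Q, hQ⟩ := Submodule.exists_isCompl (𝐀)
  -- an arbitrary linear projection onto `A`
  set π : Matrix X X ℂ →ₗ[ℂ] Matrix X X ℂ := Submodule.projection _ Q hQ with hπ
  have hπ_mem : ∀ M, π M ∈ 𝐀 := fun M => Submodule.projection_apply_mem hQ M
  have hπ_id : ∀ a ∈ 𝐀, π a = a := fun a ha => Submodule.projection_apply_of_mem_left hQ ha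
  -- its Maschke average `Pa M = |G|⁻¹ ∑_g P_g π(P_{g⁻¹} M)`
  set Pa : Matrix X X ℂ →ₗ[ℂ] Matrix X X ℂ := (Fintype.card G : ℂ)⁻¹ •
    ∑ g : G, LinearMap.mulLeft ℂ (𝐏[g]) ∘ₗ π ∘ₗ LinearMap.mulLeft ℂ (𝐏[g⁻¹]) with hPa
  have hPa_apply : ∀ M, Pa M = (Fintype.card G : ℂ)⁻¹ • ∑ g : G, 𝐏[g] * π (𝐏[g⁻¹] * M) := by
    intro M
    simp only [hPa, LinearMap.smul_apply, LinearMap.coe_sum, Finset.sum_apply,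
      LinearMap.comp_apply, LinearMap.mulLeft_apply]
  have hPa_mem : ∀ M, Pa M ∈ 𝐀 := by
    intro M
    rw [hPa_apply]
    exact Submodule.smul_mem _ _ (Submodule.sum_mem _ fun g _ => permMat_mul_mem g (hπ_mem _))
  have hcard : (Fintype.card G : ℂ) ≠ 0 := Nat.cast_ne_zero.2 Fintype.card_ne_zero
  have hPa_id : ∀ a ∈ 𝐀, Pa a = a := by
    intro a ha
    rw [hPa_apply]
    have : ∀ g : G, 𝐏[g] * π (𝐏[g⁻¹] * a) = a := by
      intro g
      rw [hπ_id _ (permMat_mul_mem g⁻¹ ha), permMat_mul_inv_cancel]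
    simp only [this, Finset.sum_const, Finset.card_univ, ← Nat.cast_smul_eq_nsmul ℂ, smul_smul,
      inv_mul_cancel₀ hcard, one_smul]
  have hPa_equiv : ∀ (h : G) (M : Matrix X X ℂ), Pa (𝐏[h] * M) = 𝐏[h] * Pa M := by
    intro h M
    rw [hPa_apply, hPa_apply, Matrix.mul_smul, Finset.mul_sum]
    congr 1
    -- reindex `g ↦ h * g`
    have aux : ∀ g : G,
        𝐏[h * g] * π (𝐏[(h * g)⁻¹] * (𝐏[h] * M)) = 𝐏[h] * (𝐏[g] * π (𝐏[g⁻¹] * M)) := by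
      intro g
      rw [_root_.mul_inv_rev, permMat_mul, permMat_mul, Matrix.mul_assoc, Matrix.mul_assoc,
        permMat_inv_mul_cancel]
    rw [← Equiv.sum_comp (Equiv.mulLeft h)]
    exact Finset.sum_congr rfl fun g _ => aux g
  -- the column maps of `Pa` are invariant matrices
  set Bm : X → X → Matrix X X ℂ := fun k l => Matrix.of fun y x => Pa (Matrix.single x l 1) y k
    with hBm
  have hB_inv : ∀ (k l : X) (g : G) (x y : X), Bm k l (g • x) (g • y) = Bm k l x y := by
    intro k l
    refine invariant_of_commute fun h => ?_
    ext y x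
    rw [permMat_mul_apply, mul_permMat_apply]
    simp only [hBm, Matrix.of_apply]
    rw [← permMat_mul_single h x l 1, hPa_equiv, permMat_mul_apply]
  have hTB : ∀ k l, T * Bm k l = Bm k l * T := fun k l => hT _ (hB_inv k l)
  -- hence `Pa (T M) = T Pa(M)`, first on matrix units
  have key_single : ∀ x l : X, Pa (T * Matrix.single x l 1) = T * Pa (Matrix.single x l 1) := by
    intro x l
    have hTs : T * Matrix.single x l 1 = ∑ y, T y x • Matrix.single y l (1 : ℂ) := by
      ext a b
      simp only [Matrix.mul_apply, Matrix.sum_apply, Matrix.smul_apply, Matrix.single_apply,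
        smul_eq_mul, mul_ite, mul_one, mul_zero]
      rw [Fintype.sum_eq_single x fun j hj => by rw [if_neg fun h => hj h.1.symm],
        Fintype.sum_eq_single a fun y hy => by rw [if_neg fun h => hy h.1]]
      simp
    rw [hTs, map_sum]
    ext a k
    simp only [map_smul, Matrix.sum_apply, Matrix.smul_apply, smul_eq_mul]
    have h1 : ∀ y, Pa (Matrix.single y l 1) a k = Bm k l a y := fun y => rfl
    simp only [h1]
    have h2 : ∑ y, T y x * Bm k l a y = (Bm k l * T) a x := by
      simp only [Matrix.mul_apply]
      exact Finset.sum_congr rfl fun y _ => mul_comm _ _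
    rw [h2, ← hTB, Matrix.mul_apply, Matrix.mul_apply]
    rfl
  have key : ∀ M, Pa (T * M) = T * Pa M := by
    intro M
    rw [Matrix.matrix_eq_sum_single M]
    simp only [Finset.mul_sum, map_sum]
    refine Finset.sum_congr rfl fun x _ => Finset.sum_congr rfl fun l _ => ?_
    have hs : Matrix.single x l (M x l) = M x l • Matrix.single x l (1 : ℂ) := by
      rw [Matrix.smul_single, smul_eq_mul, mul_one]
    rw [hs, Matrix.mul_smul, map_smul, map_smul, key_single, Matrix.mul_smul]
  -- conclude `T = T Pa(1) = Pa(T) ∈ A`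
  have hT1 : T = Pa T := by
    conv_lhs => rw [← Matrix.mul_one T, ← hPa_id 1 one_mem_permSpan, ← key, Matrix.mul_one]
  rw [hT1]
  exact hPa_mem T

end GelfandRankFormula

end Summit.MatrixMultiplication.MatrixMultiplication.Theorems
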